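import Literature.AlgebraicGeometry.Resolution.HasseSchmidtDiffEqDiffOp
import HarnessLib

/-!
# EGA IV₄ Thm. 16.11.2 for affine space, BASIS form: the `D^{(α)}` are a free basis of `Diff_{R[x_σ]/R}`

Topic `Literature/AlgebraicGeometry/Resolution` — companion of `HasseSchmidtDerivatives.lean` (`hasseDeriv R α = D^{(α)}`,
`HasseSchmidtDiff σ R n`), `HasseSchmidtDiffEqDiffOp.lean` (SPANNING: `HasseSchmidtDiff σ R n = diffOp R (MvPolynomial σ R) n`
for `σ` finite, and the monomial formula `hasseDeriv_monomial`) and `DifferentialOperators.lean` (`IsDiffOpLE`, `diffOp`).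

EGA IV₄ Thm. (16.11.2), last clause (held copy `paper:doi-10-1007-bf02732123`, PDF p.53 l.35–40 = journal p.54):
«Enfin, si `L` est fini, pour tout entier `m`, les `D_p` tels que `|p| ≤ m` forment une base du `𝒪_U`-Module `Diff^m`,
autrement dit, tout opérateur différentiel d'ordre `≤ m` sur `U` s'écrit d'une seule façon sous la forme
`D = Σ_{|p| ≤ m} a_p D_p` où les `a_p` sont des sections de `𝒪_X` au-dessus de `U`.» For `U = 𝔸^σ_R → Spec R`, `σ`
finite, `R` any commutative ring, this file adds the UNIQUENESS («d'une seule façon») to the tree's spanning theorem: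

* `linearIndependent_hasseDeriv` — the family `(D^{(α)})_{α ∈ ℕ^σ}` is linearly independent over `R[x_σ]` (any `σ`
  with decidable equality, any commutative `R`): evaluate a vanishing combination at `x^{α₀}` for `α₀` minimal among the
  indices with non-zero coefficient — by `hasseDeriv_monomial` only the `α₀`-term survives, with value that coefficient;
* `hasseDiffBasisLE σ R m` — for `σ` finite, the `D^{(α)}`, `|α| ≤ m`, form a `Module.Basis` of `Diff^{≤ m}_{R[x_σ]/R}`
  indexed by `{α // |α| ≤ m}` (the printed statement), `hasseDiffBasisLE_apply`;
* `hasseDiffBasis σ R` — all the `D^{(α)}` form a `Module.Basis` of `Diff_{R[x_σ]/R} = ⨆_m Diff^{≤ m}` indexed by `ℕ^σ`,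
  `hasseDiffBasis_apply`; `iSup_diffOp_le_span_hasseDeriv`.

Bearing (index only; nothing from it is used or asserted): H. Hironaka, ms. 2017, Rem. 3.5 p.9 «there exists a free basis
{∂^a = ∂^a_x, a ∈ ℤ^n_0} of the 𝒪_ξ-module Diff_{Z,ξ}» (campaign res-hironaka, typed candidate
`Hironaka2017.S03DiffARNE.Rem3_5_basis`, row 023): this file is the affine-space case as tree library.

## References
* [EGAIV4] A. Grothendieck, J. Dieudonné, ÉGA IV₄, Publ. Math. IHÉS 32 (1967), Thm. 16.11.2 (last clause) with
  (16.11.2.1); read on the held copy, PDF p.53 l.13–40.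
-/

noncomputable section

open MvPolynomial

namespace Literature.AlgebraicGeometry.Resolution

section HasseBasis

variable (σ : Type*) (R : Type*) [CommRing R]

/-- **The Hasse–Schmidt derivatives `D^{(α)}`, `α ∈ ℕ^σ`, are linearly independent over `R[x_σ]`** — the
«d'une seule façon» of EGA IV₄ 16.11.2: a vanishing `R[x_σ]`-combination, evaluated at the monomial `x^{α₀}` for `α₀`
minimal among the indices with non-zero coefficient, returns that coefficient (`D^{(α)}(x^{α₀}) = 0` unless
`α ≤ α₀`, and `D^{(α₀)}(x^{α₀}) = 1`). [cite: EGAIV4, Thm. 16.11.2 (last clause: «s'écrit d'une seule façon»)] -/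
theorem linearIndependent_hasseDeriv [DecidableEq σ] :
    LinearIndependent (MvPolynomial σ R)
      (fun α : σ →₀ ℕ => (hasseDeriv R α : MvPolynomial σ R →ₗ[R] MvPolynomial σ R)) := by
  classical
  rw [linearIndependent_iff']
  intro s g hsum
  by_contra hne
  push Not at hne
  obtain ⟨i₀, hi₀s, hgi₀⟩ := hne
  set T : Finset (σ →₀ ℕ) := s.filter fun i => g i ≠ 0 with hT
  have hTne : T.Nonempty := ⟨i₀, by rw [hT, Finset.mem_filter]; exact ⟨hi₀s, hgi₀⟩⟩
  obtain ⟨α₀, hα₀T, hmin⟩ := T.exists_minimal hTne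
  rw [hT, Finset.mem_filter] at hα₀T
  obtain ⟨hα₀s, hgα₀⟩ := hα₀T
  have heval := congrArg (fun E : MvPolynomial σ R →ₗ[R] MvPolynomial σ R => E (monomial α₀ 1)) hsum
  simp only [LinearMap.coe_sum, Finset.sum_apply, LinearMap.smul_apply, LinearMap.zero_apply,
    smul_eq_mul] at heval
  have hterm : ∀ i ∈ s, g i * hasseDeriv R i (monomial α₀ (1 : R)) = if i = α₀ then g α₀ else 0 := by
    intro i hi
    split_ifs with hi0
    · subst hi0
      rw [hasseDeriv_monomial_self, C_1, mul_one]
    · by_cases hgi : g i = 0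
      · rw [hgi, zero_mul]
      · have hle : ¬ i ≤ α₀ := by
          intro hle
          have hiT : i ∈ T := by rw [hT, Finset.mem_filter]; exact ⟨hi, hgi⟩
          exact hi0 (le_antisymm hle (hmin hiT hle))
        rw [hasseDeriv_monomial_eq_zero_of_not_le R hle, mul_zero]
  rw [Finset.sum_congr rfl hterm, Finset.sum_ite_eq' s α₀, if_pos hα₀s] at heval
  exact hgα₀ heval

/-- `D^{(α)} ∈ Diff_{R[x_σ]/R} = ⨆_m Diff^{≤ m}` (it has order `≤ |α|`). [cite: EGAIV4, Thm. 16.11.2] -/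
theorem hasseDeriv_mem_iSup_diffOp [DecidableEq σ] (α : σ →₀ ℕ) :
    hasseDeriv R α ∈ ⨆ m : ℕ, diffOp R (MvPolynomial σ R) m :=
  Submodule.mem_iSup_of_mem α.degree (hasseDeriv_mem_diffOp R α)

variable {σ R} in
/-- Plumbing: if a submodule `N` is contained in the span of a family `v` of its own elements, then the corestricted
family spans `N` as a module in its own right (private helper). [folklore] -/
private theorem top_le_span_range_mk {M : Type*} [AddCommGroup M] [Module (MvPolynomial σ R) M]
    {ι : Type*} (N : Submodule (MvPolynomial σ R) M) (v : ι → M) (hv : ∀ i, v i ∈ N)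
    (hN : N ≤ Submodule.span (MvPolynomial σ R) (Set.range v)) :
    (⊤ : Submodule (MvPolynomial σ R) N) ≤
      Submodule.span (MvPolynomial σ R) (Set.range fun i => (⟨v i, hv i⟩ : N)) := by
  rintro ⟨x, hx⟩ -
  have key : Submodule.map N.subtype
      (Submodule.span (MvPolynomial σ R) (Set.range fun i => (⟨v i, hv i⟩ : N))) =
        Submodule.span (MvPolynomial σ R) (Set.range v) := by
    rw [Submodule.map_span, ← Set.range_comp]
    rfl
  have hx' : x ∈ Submodule.map N.subtype
      (Submodule.span (MvPolynomial σ R) (Set.range fun i => (⟨v i, hv i⟩ : N))) := by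
    rw [key]; exact hN hx
  obtain ⟨y, hy, hyx⟩ := hx'
  have : y = ⟨x, hx⟩ := Subtype.ext hyx
  rw [← this]
  exact hy

variable [Fintype σ] [DecidableEq σ]

/-- For `σ` finite: `Diff_{R[x_σ]/R} = ⨆_m Diff^{≤ m}` is contained in (hence equals) the `R[x_σ]`-span of the
`D^{(α)}` (from the tree's spanning theorem `hasseSchmidtDiff_eq_diffOp_of_fintype` in each order).
[cite: EGAIV4, Thm. 16.11.2] -/
theorem iSup_diffOp_le_span_hasseDeriv :
    (⨆ m : ℕ, diffOp R (MvPolynomial σ R) m) ≤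
      Submodule.span (MvPolynomial σ R)
        (Set.range fun α : σ →₀ ℕ => (hasseDeriv R α : MvPolynomial σ R →ₗ[R] MvPolynomial σ R)) := by
  refine iSup_le fun m => ?_
  rw [← hasseSchmidtDiff_eq_diffOp_of_fintype R m, HasseSchmidtDiff]
  refine Submodule.span_mono ?_
  rintro _ ⟨α, -, rfl⟩
  exact ⟨α, rfl⟩

/-- **EGA IV₄ Thm. 16.11.2, basis form (all orders at once): the `D^{(α)}`, `α ∈ ℕ^σ`, form a free basis of the
`R[x_σ]`-module `Diff_{R[x_σ]/R} = ⨆_m Diff^{≤ m}`** (`σ` finite, `R` any commutative ring).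
[cite: EGAIV4, Thm. 16.11.2 (last clause)] -/
def hasseDiffBasis :
    Module.Basis (σ →₀ ℕ) (MvPolynomial σ R) ↥(⨆ m : ℕ, diffOp R (MvPolynomial σ R) m) :=
  Module.Basis.mk
    (v := fun α => (⟨hasseDeriv R α, hasseDeriv_mem_iSup_diffOp σ R α⟩ :
      ↥(⨆ m : ℕ, diffOp R (MvPolynomial σ R) m)))
    (LinearIndependent.of_comp (Submodule.subtype _) (linearIndependent_hasseDeriv σ R))
    (top_le_span_range_mk _ _ _ (iSup_diffOp_le_span_hasseDeriv σ R))

/-- The basis vectors are the `D^{(α)}`. [cite: EGAIV4, Thm. 16.11.2] -/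
theorem hasseDiffBasis_apply (α : σ →₀ ℕ) :
    ((hasseDiffBasis σ R α : ↥(⨆ m : ℕ, diffOp R (MvPolynomial σ R) m)) :
        MvPolynomial σ R →ₗ[R] MvPolynomial σ R) = hasseDeriv R α := by
  rw [hasseDiffBasis, Module.Basis.mk_apply]

/-- **EGA IV₄ Thm. 16.11.2, basis form in each order (the printed statement): for `σ` finite, the `D^{(α)}` with
`|α| ≤ m` form a free basis of the `R[x_σ]`-module `Diff^{≤ m}_{R[x_σ]/R}`.**
[cite: EGAIV4, Thm. 16.11.2 (last clause: «les D_p tels que |p| ≤ m forment une base du Module Diff^m»)] -/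
def hasseDiffBasisLE (m : ℕ) :
    Module.Basis {α : σ →₀ ℕ // α.degree ≤ m} (MvPolynomial σ R) ↥(diffOp R (MvPolynomial σ R) m) :=
  Module.Basis.mk
    (v := fun α => (⟨hasseDeriv R α.1, (hasseSchmidtDiff_le_diffOp σ R m)
        (hasseDeriv_mem_hasseSchmidtDiff σ R α.2)⟩ : ↥(diffOp R (MvPolynomial σ R) m)))
    (LinearIndependent.of_comp (Submodule.subtype _)
      ((linearIndependent_hasseDeriv σ R).comp (fun α : {α : σ →₀ ℕ // α.degree ≤ m} => α.1)
        Subtype.val_injective))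
    (top_le_span_range_mk _ _ _ (by
      rw [← hasseSchmidtDiff_eq_diffOp_of_fintype R m, HasseSchmidtDiff]
      refine Submodule.span_mono ?_
      rintro _ ⟨α, hα, rfl⟩
      exact ⟨⟨α, hα⟩, rfl⟩))

/-- The basis vectors are the `D^{(α)}`, `|α| ≤ m`. [cite: EGAIV4, Thm. 16.11.2] -/
theorem hasseDiffBasisLE_apply (m : ℕ) (α : {α : σ →₀ ℕ // α.degree ≤ m}) :
    ((hasseDiffBasisLE σ R m α : ↥(diffOp R (MvPolynomial σ R) m)) :
        MvPolynomial σ R →ₗ[R] MvPolynomial σ R) = hasseDeriv R α.1 := by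
  rw [hasseDiffBasisLE, Module.Basis.mk_apply]

/-- **Unique expression** (EGA's «s'écrit d'une seule façon»): every operator of order `≤ m` on `R[x_σ]` is
`Σ_{|α| ≤ m} a_α · D^{(α)}` for a UNIQUE family of coefficients `a_α ∈ R[x_σ]` — the coordinates in `hasseDiffBasisLE`.
[cite: EGAIV4, Thm. 16.11.2 (last clause)] -/
theorem existsUnique_repr (m : ℕ) {D : MvPolynomial σ R →ₗ[R] MvPolynomial σ R}
    (hD : IsDiffOpLE R m D) :
    ∃! a : {α : σ →₀ ℕ // α.degree ≤ m} →₀ MvPolynomial σ R,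
      (a.sum fun α c => c • (hasseDeriv R α.1 : MvPolynomial σ R →ₗ[R] MvPolynomial σ R)) = D := by
  let b := hasseDiffBasisLE σ R m
  refine ⟨b.repr ⟨D, hD⟩, ?_, ?_⟩
  · have h := b.linearCombination_repr ⟨D, hD⟩
    rw [Finsupp.linearCombination_apply] at h
    have h' := congrArg (Submodule.subtype (diffOp R (MvPolynomial σ R) m)) h
    rw [map_finsuppSum] at h'
    simpa [b, hasseDiffBasisLE_apply] using h'
  · intro a ha
    apply b.repr.symm.injective
    rw [LinearEquiv.symm_apply_apply]
    apply Subtype.ext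
    have hcoe : ((b.repr.symm a : ↥(diffOp R (MvPolynomial σ R) m)) :
        MvPolynomial σ R →ₗ[R] MvPolynomial σ R) =
          a.sum fun α c => c • (hasseDeriv R α.1 : MvPolynomial σ R →ₗ[R] MvPolynomial σ R) := by
      rw [Module.Basis.repr_symm_apply, Finsupp.linearCombination_apply]
      change (diffOp R (MvPolynomial σ R) m).subtype (a.sum fun i c => c • b i) = _
      rw [map_finsuppSum]
      simp [b, hasseDiffBasisLE_apply]
    change ((b.repr.symm a : ↥(diffOp R (MvPolynomial σ R) m)) :
        MvPolynomial σ R →ₗ[R] MvPolynomial σ R) = D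
    rw [hcoe, ha]

end HasseBasis

end Literature.AlgebraicGeometry.Resolution

end
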